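import Summits.MatrixMultiplication.OmegaCensus.SmallFormats.GF2TransposeLookup
import Summits.MatrixMultiplication.OmegaCensus.SmallFormats.GF2OrbitSweep
import HarnessLib

/-!
# ω-census family (a), GF(2) rank floors: FAST sandwich checks (pull back the constraint forms instead of enumerating the subspace)

Cell `pub-mm22` (MatrixMultiplication venture, Route D3-STRETCH `⟨3,3,3⟩/𝔽₂ ≥ 20`, seat p3), topic
`Summits/MatrixMultiplication/OmegaCensus` (sub-folder `SmallFormats`, next to `GF2OrbitChecks.lean` /
`GF2TransposeLookup.lean`). HONEST FRAMING: checker plumbing, PROVED (0 sorry); no bound is claimed here.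

The landed lookup checks `sandB` (GF2OrbitChecks.lean, cell `pub-omega`) and `sandTB` (GF2TransposeLookup.lean, LIT-2)
verify `P x Q ∈ S_{Kt}` (resp. `P xᵀ Q ∈ S_{Kt}`) for EVERY bit pattern `x < 2^{l m}` — for `⟨3,3,3⟩` that is 512 patterns and
two bit-matrix products each, ≈ 1.4 s of kernel time per table entry (measured), and the `⟨3,3,3⟩` certificates carry
≈ 10⁴ table entries. The same inclusion `P S_{Kr} Q ⊆ S_{Kt}` holds iff every constraint form `κ ∈ Kt` PULLS BACK to a form
vanishing on `S_{Kr}`: `κ(P X Q) = (Pᵀ κ Qᵀ)(X)` (`form_sandwich`, a trace identity), and vanishing on `S_{Kr}` is implied by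
`reduceB Kr (Pᵀ κ Qᵀ) = 0` (`form_reduceB_eq`). So `sandFB` / `sandTFB` test `|Kt|` pull-backs (a few bit products each)
instead of `2^{l m}` patterns, and `sandB_of_sandFB` / `sandTB_of_sandTFB` transfer the result to the landed checks, whose
soundness theorems (`le_of_sandB`, `le_of_sandTB`) then apply unchanged; `tableOK_of_fast` / `tableTOK_of_fast` lift this to
whole lookup tables (`tableOK` of GF2OrbitSweep.lean, `tableTOK`-shaped `List.all` checks).
-/

namespace Summit.MatrixMultiplication.OmegaCensus.GF2RankLB

open Module Matrix Literature.Computability.AlgebraicComplexity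

/-! ## Forms as traces and the pull-back identity -/

/-- A bit-pattern form is the trace pairing with its coefficient matrix: `κ(X) = tr((ofBits κ)ᵀ X)`. -/
theorem form_eq_trace (l m κ : ℕ) (X : Matrix (Fin l) (Fin m) (ZMod 2)) :
    form l m κ X = Matrix.trace ((ofBits l m κ)ᵀ * X) := by
  rw [form_apply, Matrix.trace, Finset.sum_comm]
  refine Finset.sum_congr rfl fun j _ => ?_
  rw [Matrix.diag_apply, Matrix.mul_apply]
  refine Finset.sum_congr rfl fun i _ => ?_
  rw [Matrix.transpose_apply, ofBits_apply]
  split <;> simp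

/-- The pulled-back form of `κ` along the sandwich `X ↦ P X Q`: bits of `Pᵀ (ofBits κ) Qᵀ`. -/
def pullB (l m P Q κ : ℕ) : ℕ := mulBits l l m (trBits l l P) (mulBits l m m κ (trBits m m Q))

/-- `pullB` encodes `Pᵀ C Qᵀ`. -/
theorem ofBits_pullB (l m P Q κ : ℕ) :
    ofBits l m (pullB l m P Q κ) = (ofBits l l P)ᵀ * (ofBits l m κ * (ofBits m m Q)ᵀ) := by
  rw [pullB, ofBits_mulBits, ofBits_mulBits, ofBits_trBits, ofBits_trBits]

/-- **Pull-back identity**: `κ(P X Q) = (Pᵀ κ Qᵀ)(X)`. -/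
theorem form_sandwich (l m P Q κ : ℕ) (X : Matrix (Fin l) (Fin m) (ZMod 2)) :
    form l m κ (ofBits l l P * X * ofBits m m Q) = form l m (pullB l m P Q κ) X := by
  rw [form_eq_trace, form_eq_trace, ofBits_pullB]
  simp only [Matrix.transpose_mul, Matrix.transpose_transpose, Matrix.mul_assoc]
  -- tr (Cᵀ (P (X Q))) = tr (Q (Cᵀ (P X)))
  rw [← Matrix.mul_assoc (ofBits l l P), ← Matrix.mul_assoc ((ofBits l m κ)ᵀ), Matrix.trace_mul_comm,
    ← Matrix.mul_assoc, ← Matrix.mul_assoc]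

/-- The pulled-back form of `κ` along the transposed sandwich `X ↦ P Xᵀ Q` (square `l × l`): bits of `Q (ofBits κ)ᵀ P`. -/
def pullTB (l P Q κ : ℕ) : ℕ := mulBits l l l Q (mulBits l l l (trBits l l κ) P)

/-- `pullTB` encodes `Q Cᵀ P`. -/
theorem ofBits_pullTB (l P Q κ : ℕ) :
    ofBits l l (pullTB l P Q κ) = ofBits l l Q * ((ofBits l l κ)ᵀ * ofBits l l P) := by
  rw [pullTB, ofBits_mulBits, ofBits_mulBits, ofBits_trBits]

/-- **Transposed pull-back identity**: `κ(P Xᵀ Q) = (Q κᵀ P)(X)`. -/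
theorem form_sandwichT (l P Q κ : ℕ) (X : Matrix (Fin l) (Fin l) (ZMod 2)) :
    form l l κ (ofBits l l P * Xᵀ * ofBits l l Q) = form l l (pullTB l P Q κ) X := by
  rw [form_eq_trace, form_eq_trace, ofBits_pullTB,
    ← Matrix.trace_transpose ((ofBits l l κ)ᵀ * (ofBits l l P * Xᵀ * ofBits l l Q))]
  simp only [Matrix.transpose_mul, Matrix.transpose_transpose, Matrix.mul_assoc]
  -- `tr (Qᵀ (X (Pᵀ C))) = tr (Pᵀ (C (Qᵀ X)))`: a cyclic rotation by two factors
  rw [← Matrix.mul_assoc (ofBits l l Q)ᵀ, Matrix.trace_mul_comm, Matrix.mul_assoc]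

/-! ## Fast sandwich checks and their transfer to the landed checks -/

/-- Fast plain sandwich check: inverse witnesses, and every `κ ∈ Kt` pulls back to a form reducing to `0` modulo `Kr`. -/
def sandFB (l m : ℕ) (Kr Kt : List ℕ) (P Pi Q Qi : ℕ) : Bool :=
  (mulBits l l l Pi P == oneBits l) && (mulBits m m m Q Qi == oneBits m) &&
    Kt.all fun κ => reduceB Kr (pullB l m P Q κ) == 0

/-- Fast transposed sandwich check (square first factor). -/
def sandTFB (l : ℕ) (Kr Kt : List ℕ) (P Pi Q Qi : ℕ) : Bool :=
  (mulBits l l l Pi P == oneBits l) && (mulBits l l l Q Qi == oneBits l) &&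
    Kt.all fun κ => reduceB Kr (pullTB l P Q κ) == 0

/-- **Transfer**: the fast plain check implies the landed `sandB`. -/
theorem sandB_of_sandFB {l m : ℕ} {Kr Kt : List ℕ} {P Pi Q Qi : ℕ} (h : sandFB l m Kr Kt P Pi Q Qi = true) :
    sandB l m Kr Kt P Pi Q Qi = true := by
  simp only [sandFB, Bool.and_eq_true, beq_iff_eq, List.all_eq_true] at h
  obtain ⟨⟨hP, hQ⟩, hall⟩ := h
  simp only [sandB, Bool.and_eq_true, beq_iff_eq]
  refine ⟨⟨hP, hQ⟩, ?_⟩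
  rw [allLT_iff]
  intro x _
  cases hm : memB (l * m) Kr x
  · simp
  · simp only [Bool.not_true, Bool.false_or]
    have hxmem : ofBits l m x ∈ subOf l m Kr := (ofBits_mem_subOf_iff l m Kr x).2 hm
    rw [← ofBits_mem_subOf_iff, ofBits_mulBits, ofBits_mulBits]
    refine mem_constrSub.2 fun κ' hκ' => ?_
    obtain ⟨κ, hκ, rfl⟩ := List.mem_map.1 hκ'
    rw [form_sandwich, ← form_reduceB_eq Kr _ _ hxmem, hall κ hκ, form_zero, LinearMap.zero_apply]

/-- **Transfer**: the fast transposed check implies the landed `sandTB`. -/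
theorem sandTB_of_sandTFB {l : ℕ} {Kr Kt : List ℕ} {P Pi Q Qi : ℕ} (h : sandTFB l Kr Kt P Pi Q Qi = true) :
    sandTB l Kr Kt P Pi Q Qi = true := by
  simp only [sandTFB, Bool.and_eq_true, beq_iff_eq, List.all_eq_true] at h
  obtain ⟨⟨hP, hQ⟩, hall⟩ := h
  simp only [sandTB, Bool.and_eq_true, beq_iff_eq]
  refine ⟨⟨hP, hQ⟩, ?_⟩
  rw [allLT_iff]
  intro x _
  cases hm : memB (l * l) Kr x
  · simp
  · simp only [Bool.not_true, Bool.false_or]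
    have hxmem : ofBits l l x ∈ subOf l l Kr := (ofBits_mem_subOf_iff l l Kr x).2 hm
    rw [← ofBits_mem_subOf_iff, ofBits_mulBits, ofBits_mulBits, ofBits_trBits]
    refine mem_constrSub.2 fun κ' hκ' => ?_
    obtain ⟨κ, hκ, rfl⟩ := List.mem_map.1 hκ'
    rw [form_sandwichT, ← form_reduceB_eq Kr _ _ hxmem, hall κ hκ, form_zero, LinearMap.zero_apply]

/-! ## Whole lookup tables -/

/-- Fast validity check of a plain lookup table (backward pointers + `sandFB`). -/
def fastTableOK (l m : ℕ) (os : List Orbit) (i : ℕ) (K cands : List ℕ)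
    (table : List (ℕ × ℕ × ℕ × ℕ × ℕ × ℕ)) : Bool :=
  table.all fun e => decide (e.2.1 < i) &&
    sandFB l m (kOf os e.2.1) (K ++ extraOf cands e.1) e.2.2.1 e.2.2.2.1 e.2.2.2.2.1 e.2.2.2.2.2

/-- Fast validity check of a transposed lookup table (backward pointers + `sandTFB`). -/
def fastTableTOK (l : ℕ) (os : List Orbit) (i : ℕ) (K cands : List ℕ)
    (tableT : List (ℕ × ℕ × ℕ × ℕ × ℕ × ℕ)) : Bool :=
  tableT.all fun e => decide (e.2.1 < i) &&
    sandTFB l (kOf os e.2.1) (K ++ extraOf cands e.1) e.2.2.1 e.2.2.2.1 e.2.2.2.2.1 e.2.2.2.2.2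

/-- **Transfer for tables**: the fast table check implies `tableOK` (GF2OrbitSweep.lean). -/
theorem tableOK_of_fast {l m : ℕ} {os : List Orbit} {i : ℕ} {K cands : List ℕ}
    {table : List (ℕ × ℕ × ℕ × ℕ × ℕ × ℕ)} (h : fastTableOK l m os i K cands table = true) :
    tableOK l m os i K cands table = true := by
  rw [fastTableOK, List.all_eq_true] at h
  rw [tableOK, List.all_eq_true]
  intro e he
  have h1 := h e he
  simp only [Bool.and_eq_true] at h1 ⊢
  exact ⟨h1.1, sandB_of_sandFB h1.2⟩

/-- **Transfer for transposed tables**: the fast check implies the `sandTB`-table check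
(the shape of `tableTOK` in GF2OrbitSweepLP.lean). -/
theorem tableTOK_of_fast {l : ℕ} {os : List Orbit} {i : ℕ} {K cands : List ℕ}
    {tableT : List (ℕ × ℕ × ℕ × ℕ × ℕ × ℕ)} (h : fastTableTOK l os i K cands tableT = true) :
    (tableT.all fun e => decide (e.2.1 < i) &&
      sandTB l (kOf os e.2.1) (K ++ extraOf cands e.1) e.2.2.1 e.2.2.2.1 e.2.2.2.2.1 e.2.2.2.2.2) = true := by
  rw [fastTableTOK, List.all_eq_true] at h
  rw [List.all_eq_true]
  intro e he
  have h1 := h e he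
  simp only [Bool.and_eq_true] at h1 ⊢
  exact ⟨h1.1, sandTB_of_sandTFB h1.2⟩

end Summit.MatrixMultiplication.OmegaCensus.GF2RankLB
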